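import Summits.AtomisticToContinuum.Crystallization.Theses.SquareWellLayerCake

/-!
# Stability of two-way window matching under perturbation of the configuration

Crux `SquareWellLayerCake.GapTwelveToBarlow` (stmt-AtomisticToContinuum-15807), line `Sketch`,
helper for the energetic stubs (`stub_strainRigidity`, `stub_uniformSpacingSelection`), whose
proofs pass through local limits of translated windows: if the `R₁`-window of `x` about `x i` and
the `R₁`-window of `y` about `y i'` are two-way `η`-close (as sets of offsets), then a two-way
`ε`-matching of the `y`-window to a template `T` (any subset of `ℝ³`, any base point `z`, any
linear isometry `A`) at radius `R₁` gives a two-way `(ε + η)`-matching of the `x`-window at every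
radius `R ≤ R₁` with `R + ε ≤ R₁`, `R + η ≤ R₁` — same template, base point and isometry
(`matched_of_close`).  Specialisations: the crux's conclusion predicate (`barlowMatched_of_close`,
template `barlowStacking a h s`) and monotonicity in `(R, ε)` (`matched_mono`).

Mathlib + `BarlowStacking` only; no named fact is used.
-/

noncomputable section

namespace Summit.AtomisticToContinuum.Crystallization.Theorems.SquareWellLayerCakeGapTwelveToBarlow

open Literature.MathematicalPhysics.StatisticalMechanics

/-- **Stability of two-way matching under `η`-perturbation of the window.**  Template `T`, base
point `z`, isometry `A` arbitrary; the `y`-window about `y i'` is `ε`-matched at radius `R₁`; the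
`x`-window about `x i` is two-way `η`-close to it at radius `R₁`; then the `x`-window is
`(ε + η)`-matched at every radius `R ≤ R₁` with `R + ε ≤ R₁` and `R + η ≤ R₁`. [folklore] -/
theorem matched_of_close {N M : ℕ} {x : Fin N → EuclideanSpace ℝ (Fin 3)}
    {y : Fin M → EuclideanSpace ℝ (Fin 3)} {i : Fin N} {i' : Fin M}
    {T : Set (EuclideanSpace ℝ (Fin 3))} {z : EuclideanSpace ℝ (Fin 3)}
    {A : EuclideanSpace ℝ (Fin 3) →ₗᵢ[ℝ] EuclideanSpace ℝ (Fin 3)} {R R₁ ε η : ℝ}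
    (hR₁ : R ≤ R₁) (hRε : R + ε ≤ R₁) (hRη : R + η ≤ R₁)
    (h1 : ∀ p ∈ T, dist p z ≤ R₁ → ∃ j' : Fin M, dist (y j') (y i' + A (p - z)) ≤ ε)
    (h2 : ∀ j' : Fin M, dist (y j') (y i') ≤ R₁ → ∃ p ∈ T, dist (y j') (y i' + A (p - z)) ≤ ε)
    (c1 : ∀ j : Fin N, dist (x j) (x i) ≤ R₁ → ∃ j' : Fin M, dist (y j' - y i') (x j - x i) ≤ η)
    (c2 : ∀ j' : Fin M, dist (y j') (y i') ≤ R₁ → ∃ j : Fin N, dist (x j - x i) (y j' - y i') ≤ η) :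
    (∀ p ∈ T, dist p z ≤ R → ∃ j : Fin N, dist (x j) (x i + A (p - z)) ≤ ε + η) ∧
    (∀ j : Fin N, dist (x j) (x i) ≤ R → ∃ p ∈ T, dist (x j) (x i + A (p - z)) ≤ ε + η) := by
  constructor
  · intro p hp hpz
    obtain ⟨j', hj'⟩ := h1 p hp (hpz.trans hR₁)
    -- `y j'` lies within `R + ε ≤ R₁` of `y i'`
    have hnorm : ‖A (p - z)‖ ≤ R := by rw [A.norm_map, ← dist_eq_norm]; exact hpz
    have hyR : dist (y j') (y i') ≤ R₁ := by
      calc dist (y j') (y i') ≤ dist (y j') (y i' + A (p - z)) + dist (y i' + A (p - z)) (y i') :=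
            dist_triangle _ _ _
        _ ≤ ε + R := by
            rw [dist_eq_norm (y i' + A (p - z)), add_sub_cancel_left]
            linarith
        _ ≤ R₁ := by linarith
    obtain ⟨j, hj⟩ := c2 j' hyR
    refine ⟨j, ?_⟩
    calc dist (x j) (x i + A (p - z))
        = dist (x j - x i) (A (p - z)) := by rw [← dist_sub_right (x j) (x i + A (p - z)) (x i)]; congr 1; abel
      _ ≤ dist (x j - x i) (y j' - y i') + dist (y j' - y i') (A (p - z)) := dist_triangle _ _ _
      _ ≤ η + ε := by
          have : dist (y j' - y i') (A (p - z)) = dist (y j') (y i' + A (p - z)) := by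
            rw [← dist_sub_right (y j') (y i' + A (p - z)) (y i')]; congr 1; abel
          rw [this]; linarith
      _ = ε + η := add_comm _ _
  · intro j hj
    obtain ⟨j', hj'⟩ := c1 j (hj.trans hR₁)
    have hyR : dist (y j') (y i') ≤ R₁ := by
      have : dist (y j' - y i') 0 ≤ dist (y j' - y i') (x j - x i) + dist (x j - x i) 0 := dist_triangle _ _ _
      rw [dist_zero_right, dist_zero_right, ← dist_eq_norm, ← dist_eq_norm] at this
      linarith
    obtain ⟨p, hp, hpj⟩ := h2 j' hyR
    refine ⟨p, hp, ?_⟩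
    calc dist (x j) (x i + A (p - z))
        = dist (x j - x i) (A (p - z)) := by rw [← dist_sub_right (x j) (x i + A (p - z)) (x i)]; congr 1; abel
      _ ≤ dist (x j - x i) (y j' - y i') + dist (y j' - y i') (A (p - z)) := dist_triangle _ _ _
      _ ≤ η + ε := by
          have : dist (y j' - y i') (A (p - z)) = dist (y j') (y i' + A (p - z)) := by
            rw [← dist_sub_right (y j') (y i' + A (p - z)) (y i')]; congr 1; abel
          rw [this, dist_comm]; linarith
      _ = ε + η := add_comm _ _

/-- **Barlow windows are stable under `η`-perturbation**: if the `R₁`-windows of `x` about `x i`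
and of `y` about `y i'` are two-way `η`-close and `y` is `(R₁, ε)`-Barlow-matched at `i'` (the
crux's conclusion predicate), then `x` is `(R, ε + η)`-Barlow-matched at `i` for `R ≤ R₁`,
`R + ε ≤ R₁`, `R + η ≤ R₁` (same `a h s z A`). [folklore] -/
theorem barlowMatched_of_close {N M : ℕ} {x : Fin N → EuclideanSpace ℝ (Fin 3)}
    {y : Fin M → EuclideanSpace ℝ (Fin 3)} {i : Fin N} {i' : Fin M} {R R₁ ε η : ℝ}
    (hR₁ : R ≤ R₁) (hRε : R + ε ≤ R₁) (hRη : R + η ≤ R₁)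
    (hy : ∃ a h : ℝ, 1 / 2 < a ∧ a < 2 ∧ 1 / 2 < h ∧ h < 2 ∧ ∃ s : ℤ → ℤ, IsHaggSeq s ∧
      ∃ z ∈ barlowStacking a h s, ∃ A : EuclideanSpace ℝ (Fin 3) →ₗᵢ[ℝ] EuclideanSpace ℝ (Fin 3),
        (∀ p ∈ barlowStacking a h s, dist p z ≤ R₁ → ∃ j : Fin M, dist (y j) (y i' + A (p - z)) ≤ ε) ∧
        (∀ j : Fin M, dist (y j) (y i') ≤ R₁ → ∃ p ∈ barlowStacking a h s, dist (y j) (y i' + A (p - z)) ≤ ε))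
    (c1 : ∀ j : Fin N, dist (x j) (x i) ≤ R₁ → ∃ j' : Fin M, dist (y j' - y i') (x j - x i) ≤ η)
    (c2 : ∀ j' : Fin M, dist (y j') (y i') ≤ R₁ → ∃ j : Fin N, dist (x j - x i) (y j' - y i') ≤ η) :
    ∃ a h : ℝ, 1 / 2 < a ∧ a < 2 ∧ 1 / 2 < h ∧ h < 2 ∧ ∃ s : ℤ → ℤ, IsHaggSeq s ∧
      ∃ z ∈ barlowStacking a h s, ∃ A : EuclideanSpace ℝ (Fin 3) →ₗᵢ[ℝ] EuclideanSpace ℝ (Fin 3),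
        (∀ p ∈ barlowStacking a h s, dist p z ≤ R → ∃ j : Fin N, dist (x j) (x i + A (p - z)) ≤ ε + η) ∧
        (∀ j : Fin N, dist (x j) (x i) ≤ R →
          ∃ p ∈ barlowStacking a h s, dist (x j) (x i + A (p - z)) ≤ ε + η) := by
  obtain ⟨a, h, ha1, ha2, hh1, hh2, s, hs, z, hz, A, h1, h2⟩ := hy
  obtain ⟨m1, m2⟩ := matched_of_close hR₁ hRε hRη h1 h2 c1 c2
  exact ⟨a, h, ha1, ha2, hh1, hh2, s, hs, z, hz, A, m1, m2⟩

/-- **Monotonicity of two-way matching** in the radius and the tolerance (one configuration):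
matched at `(R₁, ε₁)` ⇒ matched at `(R, ε)` for `R ≤ R₁`, `R + ε ≤ R₁`, `0 ≤ ε₁ ≤ ε` — note the
radius loss in the template clause, which is why limit arguments work at `(R + 1, ε/2)`.
[folklore] -/
theorem matched_mono {N : ℕ} {x : Fin N → EuclideanSpace ℝ (Fin 3)} {i : Fin N}
    {T : Set (EuclideanSpace ℝ (Fin 3))} {z : EuclideanSpace ℝ (Fin 3)}
    {A : EuclideanSpace ℝ (Fin 3) →ₗᵢ[ℝ] EuclideanSpace ℝ (Fin 3)} {R R₁ ε ε₁ : ℝ}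
    (hR₁ : R ≤ R₁) (hRε : R + ε ≤ R₁) (hε : ε₁ ≤ ε) (hε₁ : 0 ≤ ε₁)
    (h1 : ∀ p ∈ T, dist p z ≤ R₁ → ∃ j : Fin N, dist (x j) (x i + A (p - z)) ≤ ε₁)
    (h2 : ∀ j : Fin N, dist (x j) (x i) ≤ R₁ → ∃ p ∈ T, dist (x j) (x i + A (p - z)) ≤ ε₁) :
    (∀ p ∈ T, dist p z ≤ R → ∃ j : Fin N, dist (x j) (x i + A (p - z)) ≤ ε) ∧
    (∀ j : Fin N, dist (x j) (x i) ≤ R → ∃ p ∈ T, dist (x j) (x i + A (p - z)) ≤ ε) := by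
  have c : ∀ j : Fin N, dist (x j) (x i) ≤ R₁ → ∃ j' : Fin N, dist (x j' - x i) (x j - x i) ≤ ε - ε₁ :=
    fun j _ => ⟨j, by rw [dist_self]; linarith⟩
  have key := matched_of_close (η := ε - ε₁) hR₁ (by linarith) (by linarith) h1 h2 c c
  rw [show ε₁ + (ε - ε₁) = ε by ring] at key
  exact key

/-- **Registered closed form** (anchor of this helper file): stability of the crux's conclusion
predicate under two-way `η`-closeness of windows. [folklore] -/
theorem stub_matchingStability :
    ∀ (N M : ℕ) (x : Fin N → EuclideanSpace ℝ (Fin 3)) (y : Fin M → EuclideanSpace ℝ (Fin 3))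
      (i : Fin N) (i' : Fin M) (R R₁ ε η : ℝ), R ≤ R₁ → R + ε ≤ R₁ → R + η ≤ R₁ →
      (∃ a h : ℝ, 1 / 2 < a ∧ a < 2 ∧ 1 / 2 < h ∧ h < 2 ∧ ∃ s : ℤ → ℤ, IsHaggSeq s ∧
        ∃ z ∈ barlowStacking a h s, ∃ A : EuclideanSpace ℝ (Fin 3) →ₗᵢ[ℝ] EuclideanSpace ℝ (Fin 3),
          (∀ p ∈ barlowStacking a h s, dist p z ≤ R₁ → ∃ j : Fin M, dist (y j) (y i' + A (p - z)) ≤ ε) ∧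
          (∀ j : Fin M, dist (y j) (y i') ≤ R₁ →
            ∃ p ∈ barlowStacking a h s, dist (y j) (y i' + A (p - z)) ≤ ε)) →
      (∀ j : Fin N, dist (x j) (x i) ≤ R₁ → ∃ j' : Fin M, dist (y j' - y i') (x j - x i) ≤ η) →
      (∀ j' : Fin M, dist (y j') (y i') ≤ R₁ → ∃ j : Fin N, dist (x j - x i) (y j' - y i') ≤ η) →
      ∃ a h : ℝ, 1 / 2 < a ∧ a < 2 ∧ 1 / 2 < h ∧ h < 2 ∧ ∃ s : ℤ → ℤ, IsHaggSeq s ∧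
        ∃ z ∈ barlowStacking a h s, ∃ A : EuclideanSpace ℝ (Fin 3) →ₗᵢ[ℝ] EuclideanSpace ℝ (Fin 3),
          (∀ p ∈ barlowStacking a h s, dist p z ≤ R → ∃ j : Fin N, dist (x j) (x i + A (p - z)) ≤ ε + η) ∧
          (∀ j : Fin N, dist (x j) (x i) ≤ R →
            ∃ p ∈ barlowStacking a h s, dist (x j) (x i + A (p - z)) ≤ ε + η) :=
  fun _ _ _ _ _ _ _ _ _ _ hR₁ hRε hRη hy c1 c2 => barlowMatched_of_close hR₁ hRε hRη hy c1 c2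

end Summit.AtomisticToContinuum.Crystallization.Theorems.SquareWellLayerCakeGapTwelveToBarlow

end
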